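import Mathlib
import Literature.NumberTheory.DiophantineApproximation.SimultaneousApproxComplexityILP
import Literature.NumberTheory.DiophantineApproximation.SimultaneousApproxComplexityCodes
import Literature.Computability.Complexity.LengthCompare
import HarnessLib

/-!
# GSA in fixed dimension: the reduction to integer programming, on codes

Topic `NumberTheory/DiophantineApproximation`; machine half of the first step of the printed proof of
`Lagarias1985_gsaOfDim_mem_P` (`SimultaneousApproxComplexity.lean`). With
`SimultaneousApproxComplexityILP.lean` (the integer program `I.toILP` in `d + 1` variables,
`I.toILP.Feasible ↔ I.Yes`, its polyhedron bounded) and `SimultaneousApproxComplexityCodes.lean` (the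
tuple code `tupleE`, the total decoder `decTuple`, `range encode ∈ P`), this file proves:

* `rowsL`, `rowsL_eq` — the rows of `(ofTuple t).toILP` as an explicit functional program on the tuple
  `t = ((d, [a₀, …]), (b, (N, ε)))` (lists of integers, no `Fin`-indexed data);
* `toILP_codeFP : CodeFP tupleE ILPInstance.encoding.encode fun t => (ofTuple t).toILP` — the instance
  map is computed on codes in polynomial time (typed combinators of `CodeFP*.lean` only);
* **`gsaLangOfDim_mem_P_of_decider`** — if SOME Boolean function on ILP instances is computed on codes
  in polynomial time, is sound (`dec P = true → P.numVars = d + 1 ∧ P.Feasible`) and is complete on the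
  BOUNDED instances with `d + 1` variables, then `gsaLangOfDim d ∈ P`; and the `∀ d` form
  `Lagarias1985_gsaOfDim_mem_P_of_deciders`. The decider — Lenstra's algorithm for polytopes in fixed
  dimension — is the subject of `Literature/Computability/Complexity/IntegerProgrammingFixedDimension*.lean`.

## References

* J. C. Lagarias, SIAM J. Comput. 14 (1985) 196–209, fixed-dimension theorem (GSA in dimension `n`
  is an integer program in `n + 1` variables; H. W. Lenstra's algorithm). [Lagarias1985]
* A. Schrijver, *Theory of Linear and Integer Programming*, 1986, §6.3 p. 168; Cor. 18.7a. [Schrijver1986]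
* S. Arora, B. Barak, *Computational Complexity*, CUP 2009, §1.3, Thm. 2.8 (closure of `P`). [AroraBarak2009]
-/

namespace Literature.NumberTheory.DiophantineApproximation

open _root_.Computability
open Literature.Computability.Complexity Literature.Computability.Complexity.CodeFP
open Literature.Algebra.EuclideanLattices (encodeRat)

namespace SimultaneousApproxInstance

/-! ### The rows as a functional program on tuples -/

/-- The coefficient list of `Pi.single 0 c₀ - Pi.single (i+1) c₁ ∈ ℤ^{d+1}`:
`c₀ :: [if j = i then -c₁ else 0 | j ∈ idx]` (`idx = [0, …, d-1]`). [folklore] -/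
def upperRowL (idx : List ℕ) (c₀ c₁ : ℤ) (i : ℕ) : List ℤ :=
  c₀ :: idx.map fun j => if j = i then -c₁ else 0

/-- The normalised numerator list: all zero when `b = 0`. [folklore] -/
def normNumL (b : ℕ) (L : List ℤ) : List ℤ := if b = 0 then L.map (fun _ => 0) else L

/-- The normalised denominator: `1` when `b = 0`. [folklore] -/
def normDen (b : ℕ) : ℕ := if b = 0 then 1 else b

/-- The `upperRow`s as a program: over the enumerated normalised numerators `(i, aᵢ)`, the rows
`(s₂ aᵢ :: [-s₂ b' at i], s₁ b')`. [folklore] -/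
def upperRowsL (idx : List ℕ) (s₁ s₂ b' : ℤ) (L' : List ℤ) : List (List ℤ × ℤ) :=
  ((List.range L'.length).zip L').map fun p => (upperRowL idx (s₂ * p.2) (s₂ * b') p.1, s₁ * b')

/-- **The rows of `(ofTuple t).toILP` as a functional program** on `t = ((d, L), (b, (N, ε)))`:
`(-1 :: 0…, -1)`, `(1 :: 0…, N)`, the upper rows, and their negatives. [cite: Lagarias1985, fixed-dimension theorem (the ILP formulation)] -/
def rowsL (t : Tuple) : List (List ℤ × ℤ) :=
  ((-1 :: t.1.2.map fun _ => 0), -1) :: ((1 :: t.1.2.map fun _ => 0), (t.2.2.1 : ℤ)) ::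
    (upperRowsL (List.range t.1.2.length) t.2.2.2.num t.2.2.2.den (normDen t.2.1) (normNumL t.2.1 t.1.2) ++
      (upperRowsL (List.range t.1.2.length) t.2.2.2.num t.2.2.2.den (normDen t.2.1) (normNumL t.2.1 t.1.2)).map
        fun r => (r.1.map fun z => -z, r.2))

/-- The row-to-lists map of `ILPInstance.encode_eq_pairE`. [folklore] -/
abbrev rowL {n : ℕ} (r : (Fin n → ℤ) × ℤ) : List ℤ × ℤ := (List.ofFn r.1, r.2)

/-- `List.ofFn` over `Fin d` is a `map` over `List.range d`. [folklore] -/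
theorem ofFn_eq_map_range {α : Type} {d : ℕ} (f : ℕ → α) : (List.ofFn fun j : Fin d => f j) = (List.range d).map f := by
  rw [← List.map_coe_finRange_eq_range, List.map_map, List.ofFn_eq_map]; rfl

/-- The coefficient list of `Pi.single 0 c₀ - Pi.single i.succ c₁`. [folklore] -/
theorem ofFn_single_sub_single (d : ℕ) (c₀ c₁ : ℤ) (i : Fin d) :
    List.ofFn (Pi.single (0 : Fin (d + 1)) c₀ - Pi.single i.succ c₁) = upperRowL (List.range d) c₀ c₁ i := by
  rw [List.ofFn_succ, upperRowL]
  congr 1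
  · simp [Fin.succ_ne_zero]
  · rw [← ofFn_eq_map_range]
    congr 1
    funext j
    simp only [Pi.sub_apply, Pi.single_apply, Fin.succ_inj, (Fin.succ_ne_zero j), if_false, zero_sub,
      Fin.val_inj]
    split_ifs <;> simp

/-- `normNumL`/`normDen` are the list forms of `num'`/`den'` of `ofTuple t`. [folklore] -/
theorem normNumL_eq (t : Tuple) : normNumL t.2.1 t.1.2 = List.ofFn (ofTuple t).num' := by
  change normNumL t.2.1 t.1.2 = List.ofFn (if t.2.1 = 0 then (0 : Fin t.1.2.length → ℤ) else fun i => t.1.2.get i)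
  unfold normNumL
  split_ifs
  · rw [show (0 : Fin t.1.2.length → ℤ) = (fun _ => 0) ∘ t.1.2.get from rfl, ← List.map_ofFn, List.ofFn_get]
  · rw [List.ofFn_get]

/-- See `normNumL_eq`. [folklore] -/
theorem normDen_eq (t : Tuple) : normDen t.2.1 = (ofTuple t).den' := rfl

/-- The upper rows are the row lists of `List.ofFn upperRow`. [folklore] -/
theorem upperRowsL_eq (t : Tuple) :
    upperRowsL (List.range t.1.2.length) t.2.2.2.num t.2.2.2.den (normDen t.2.1) (normNumL t.2.1 t.1.2) =
      (List.ofFn (ofTuple t).upperRow).map rowL := by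
  rw [upperRowsL, normNumL_eq, normDen_eq, List.length_ofFn, List.map_ofFn]
  have hzip : (List.range (ofTuple t).dim).zip (List.ofFn (ofTuple t).num') =
      List.ofFn fun i : Fin (ofTuple t).dim => ((i : ℕ), (ofTuple t).num' i) := by
    apply List.ext_getElem (by simp) fun k h₁ h₂ => ?_
    simp
  change (List.map _ ((List.range (ofTuple t).dim).zip (List.ofFn (ofTuple t).num'))) = _
  rw [hzip, List.map_ofFn]
  congr 1
  funext i
  simp only [Function.comp_apply, rowL, upperRow, ofFn_single_sub_single]
  rfl

/-- **The program computes the rows of the integer program**: `rowsL t` is the list form of the rows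
of `(ofTuple t).toILP`. [cite: Lagarias1985, fixed-dimension theorem (the ILP formulation)] -/
theorem rowsL_eq (t : Tuple) : rowsL t = (ofTuple t).toILPRows.map rowL := by
  have hz : (t.1.2.map fun _ => (0 : ℤ)) = List.ofFn fun _ : Fin (ofTuple t).dim => (0 : ℤ) := by
    change _ = List.ofFn ((fun _ => (0 : ℤ)) ∘ t.1.2.get)
    rw [← List.map_ofFn, List.ofFn_get]
  have h0 : ∀ c : ℤ, List.ofFn (Pi.single (0 : Fin ((ofTuple t).dim + 1)) c) = c :: t.1.2.map fun _ => 0 := by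
    intro c
    rw [List.ofFn_succ, hz]
    simp [Fin.succ_ne_zero]
  have h0' : List.ofFn (-Pi.single (0 : Fin ((ofTuple t).dim + 1)) (1 : ℤ)) = -1 :: t.1.2.map fun _ => 0 := by
    rw [← Pi.single_neg, h0]
  have hlow : (List.ofFn (ofTuple t).lowerRow).map rowL =
      ((List.ofFn (ofTuple t).upperRow).map rowL).map fun r => (r.1.map fun z => -z, r.2) := by
    rw [List.map_ofFn, List.map_ofFn, List.map_ofFn]
    congr 1
    funext i
    simp only [Function.comp_apply, rowL, lowerRow, List.map_ofFn]
    rfl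
  change _ = (List.ofFn (-Pi.single (0 : Fin ((ofTuple t).dim + 1)) (1 : ℤ)), (-1 : ℤ)) ::
    (List.ofFn (Pi.single (0 : Fin ((ofTuple t).dim + 1)) (1 : ℤ)), ((ofTuple t).bound : ℤ)) ::
      ((List.ofFn (ofTuple t).upperRow ++ List.ofFn (ofTuple t).lowerRow).map rowL)
  rw [List.map_append, hlow, ← upperRowsL_eq, h0, h0']
  rfl

/-- Hence the code of `(ofTuple t).toILP` is the typed code of `(|L| + 1, rowsL t)`. [cite: AroraBarak2009, §0.1] -/
theorem encode_toILP_ofTuple (t : Tuple) :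
    ILPInstance.encoding.encode (ofTuple t).toILP =
      pairE natE (listE (pairE (listE smE) smE)) (t.1.2.length + 1, rowsL t) := by
  rw [toILP_eq, ILPInstance.encode_eq_pairE, rowsL_eq]; rfl

/-! ### The instance map is polynomial time on codes -/

section codeFP

/-- The inner row program is polynomial time: `((idx, (c₀, c₁)), i) ↦ upperRowL idx c₀ c₁ i`.
[cite: AroraBarak2009, §1.3] -/
theorem upperRowL_codeFP :
    CodeFP (pairE (pairE (rawE natE) (pairE intE intE)) natE) (rawE intE)
      (fun p => upperRowL p.1.1 p.1.2.1 p.1.2.2 p.2) := by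
  -- context `(i, c₁)` over the index list
  have hitem : CodeFP (pairE (pairE natE intE) natE) intE (fun q => if q.2 = q.1.1 then -q.1.2 else 0) := by
    have hp : CodeFP (pairE (pairE natE intE) natE) bitE (fun q => decide (q.2 = q.1.1)) :=
      natEq.comp ((snd _ _).pair (fst _ _).fst')
    exact (hp.ite (intNeg.comp (fst _ _).snd') (const _ 0)).congr fun q => by
      by_cases h : q.2 = q.1.1 <;> simp [h]
  have hmap := map (σ := ℕ × ℤ) (eσ := pairE natE intE) (eα := natE) (eβ := intE) hitem
  -- assemble: context (i, c₁), list idx, head c₀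
  let E := pairE (pairE (rawE natE) (pairE intE intE)) natE
  have hctx : CodeFP E (pairE natE intE) (fun p => (p.2, p.1.2.2)) := (snd _ _).pair (fst _ _).snd'.snd'
  have hidx : CodeFP E (rawE natE) (fun p => p.1.1) := (fst _ _).fst'
  have hc₀ : CodeFP E intE (fun p => p.1.2.1) := (fst _ _).snd'.fst'
  exact ((rawCons intE).comp (hc₀.pair (hmap.comp (hctx.pair hidx)))).congr fun p => rfl

/-- The upper rows are polynomial time: `((idx, (s₁, (s₂, b'))), L') ↦ upperRowsL idx s₁ s₂ b' L'`.
[cite: AroraBarak2009, §1.3] -/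
theorem upperRowsL_codeFP :
    CodeFP (pairE (pairE (rawE natE) (pairE intE (pairE intE intE))) (rawE intE)) (rawE (pairE (rawE intE) intE))
      (fun p => upperRowsL p.1.1 p.1.2.1 p.1.2.2.1 p.1.2.2.2 p.2) := by
  let C := pairE (rawE natE) (pairE intE (pairE intE intE))
  -- the item map on `(context, (i, a))`
  have hs₂ : CodeFP (pairE C (pairE natE intE)) intE (fun q => q.1.2.2.1) := (fst _ _).snd'.snd'.fst'
  have hb' : CodeFP (pairE C (pairE natE intE)) intE (fun q => q.1.2.2.2) := (fst _ _).snd'.snd'.snd'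
  have hs₁ : CodeFP (pairE C (pairE natE intE)) intE (fun q => q.1.2.1) := (fst _ _).snd'.fst'
  have hc₀ : CodeFP (pairE C (pairE natE intE)) intE (fun q => q.1.2.2.1 * q.2.2) :=
    (intMul.comp (hs₂.pair (snd _ _).snd')).congr fun _ => rfl
  have hc₁ : CodeFP (pairE C (pairE natE intE)) intE (fun q => q.1.2.2.1 * q.1.2.2.2) :=
    (intMul.comp (hs₂.pair hb')).congr fun _ => rfl
  have hrow : CodeFP (pairE C (pairE natE intE)) (rawE intE)
      (fun q => upperRowL q.1.1 (q.1.2.2.1 * q.2.2) (q.1.2.2.1 * q.1.2.2.2) q.2.1) :=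
    (upperRowL_codeFP.comp (((fst _ _).fst'.pair (hc₀.pair hc₁)).pair (snd _ _).fst')).congr fun _ => rfl
  have hitem : CodeFP (pairE C (pairE natE intE)) (pairE (rawE intE) intE)
      (fun q => (upperRowL q.1.1 (q.1.2.2.1 * q.2.2) (q.1.2.2.1 * q.1.2.2.2) q.2.1, q.1.2.1 * q.1.2.2.2)) :=
    (hrow.pair (intMul.comp (hs₁.pair hb'))).congr fun _ => rfl
  have hmap := map (σ := List ℕ × (ℤ × (ℤ × ℤ))) (eσ := C) (eα := pairE natE intE) (eβ := pairE (rawE intE) intE) hitem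
  exact (hmap.comp ((fst _ _).pair ((rawEnum intE).comp (snd _ _)))).congr fun p => rfl

/-- **The instance map `t ↦ (ofTuple t).toILP` is computed on codes in polynomial time.**
[cite: Lagarias1985, fixed-dimension theorem (reduction to ILP)] [cite: AroraBarak2009, §1.3] -/
theorem toILP_codeFP : CodeFP tupleE ILPInstance.encoding.encode (fun t => (ofTuple t).toILP) := by
  -- fields of the tuple
  have tL : CodeFP tupleE (rawE intE) (fun t => t.1.2) :=
    ((map₀ intOfSM).comp ((rawOfList smE).comp (fst _ _).snd')).congr fun t => by simp
  have tb : CodeFP tupleE natE (fun t => t.2.1) := (snd _ _).fst'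
  have tN : CodeFP tupleE intE (fun t => (t.2.2.1 : ℤ)) := (intOfNat.comp (snd _ _).snd'.fst').congr fun _ => rfl
  have tnd : CodeFP tupleE (pairE intE natE) (fun t => (t.2.2.2.num, t.2.2.2.den)) :=
    (ratNumDen.comp (snd _ _).snd'.snd').congr fun _ => rfl
  have ts₁ : CodeFP tupleE intE (fun t => t.2.2.2.num) := tnd.fst'
  have ts₂ : CodeFP tupleE intE (fun t => (t.2.2.2.den : ℤ)) := (intOfNat.comp tnd.snd').congr fun _ => rfl
  have hb0 : CodeFP tupleE bitE (fun t => decide (t.2.1 = 0)) := (natEq.comp (tb.pair (const _ 0))).congr fun _ => rfl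
  have hzeros : CodeFP tupleE (rawE intE) (fun t => t.1.2.map fun _ => (0 : ℤ)) :=
    ((map₀ (const intE (0 : ℤ))).comp tL).congr fun _ => rfl
  have tL' : CodeFP tupleE (rawE intE) (fun t => normNumL t.2.1 t.1.2) :=
    (hb0.ite hzeros tL).congr fun t => by unfold normNumL; by_cases h : t.2.1 = 0 <;> simp [h]
  have tb' : CodeFP tupleE intE (fun t => (normDen t.2.1 : ℤ)) :=
    (intOfNat.comp (hb0.ite (const _ 1) tb)).congr fun t => by unfold normDen; by_cases h : t.2.1 = 0 <;> simp [h]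
  have hidx : CodeFP tupleE (rawE natE) (fun t => List.range t.1.2.length) :=
    (urange.comp ((ulength intE).comp tL)).congr fun _ => rfl
  -- the rows
  have hups : CodeFP tupleE (rawE (pairE (rawE intE) intE))
      (fun t => upperRowsL (List.range t.1.2.length) t.2.2.2.num t.2.2.2.den (normDen t.2.1) (normNumL t.2.1 t.1.2)) :=
    (upperRowsL_codeFP.comp ((hidx.pair (ts₁.pair (ts₂.pair tb'))).pair tL')).congr fun _ => rfl
  have hneg : CodeFP (rawE (pairE (rawE intE) intE)) (rawE (pairE (rawE intE) intE))
      (fun l => l.map fun r => (r.1.map fun z => -z, r.2)) :=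
    (map₀ (((map₀ intNeg).comp (fst _ _)).pair (snd _ _))).congr fun _ => rfl
  have hR1 : CodeFP tupleE (pairE (rawE intE) intE) (fun t => ((-1 :: t.1.2.map fun _ => 0), (-1 : ℤ))) :=
    (((rawCons intE).comp ((const _ (-1 : ℤ)).pair hzeros)).pair (const _ (-1 : ℤ))).congr fun _ => rfl
  have hR2 : CodeFP tupleE (pairE (rawE intE) intE) (fun t => ((1 :: t.1.2.map fun _ => 0), (t.2.2.1 : ℤ))) :=
    (((rawCons intE).comp ((const _ (1 : ℤ)).pair hzeros)).pair tN).congr fun _ => rfl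
  have hrows : CodeFP tupleE (rawE (pairE (rawE intE) intE)) rowsL :=
    ((rawCons _).comp (hR1.pair ((rawCons _).comp (hR2.pair ((rawAppend _).comp (hups.pair (hneg.comp hups))))))).congr
      fun t => rfl
  -- recoding the output: integer lists as headed lists of sign–magnitude codes
  have hrec : CodeFP (rawE (pairE (rawE intE) intE)) (listE (pairE (listE smE) smE)) (fun l => l) := by
    have hitem : CodeFP (pairE (rawE intE) intE) (pairE (listE smE) smE) (fun r => r) :=
      ((((listOfRaw smE).comp (map₀ smOfInt)).comp (fst _ _)).pair (smOfInt.comp (snd _ _))).congr fun r => by simp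
    exact ((listOfRaw _).comp (map₀ hitem)).congr fun l => by simp
  have hlen : CodeFP tupleE natE (fun t => t.1.2.length + 1) := (natOfUn.comp (unSucc.comp ((ulength intE).comp tL))).congr fun _ => rfl
  exact (hlen.pair (hrec.comp hrows)).recodeOut fun t => (encode_toILP_ofTuple t).symm

end codeFP

/-! ### Assembly: `gsaLangOfDim d ∈ P` from a fixed-dimension ILP decider -/

/-- **GSA in fixed dimension `d` is in `P` as soon as bounded integer programs in `d + 1` variables are
decided in polynomial time** (the shape of Lagarias's proof): given a Boolean function `dec` on ILP
instances that is computed on codes by an `FP` string function, is SOUND (`dec P = true` only for feasible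
instances with `d + 1` variables) and is COMPLETE on bounded instances with `d + 1` variables, the language
`gsaLangOfDim d` is decided by `w ↦ dec ((ofTuple (decTuple w)).toILP) ∧ [w is a code]`.
[cite: Lagarias1985, fixed-dimension theorem (reduction to [LenstraHW1983])] [cite: AroraBarak2009, Thm. 2.8] -/
theorem gsaLangOfDim_mem_P_of_decider (d : ℕ) (dec : ILPInstance → Bool)
    (hFP : CodeFP ILPInstance.encoding.encode bitE dec)
    (hsound : ∀ P : ILPInstance, dec P = true → P.numVars = d + 1 ∧ P.Feasible)
    (hcomplete : ∀ P : ILPInstance, P.numVars = d + 1 → P.IsBounded → P.Feasible → dec P = true) :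
    gsaLangOfDim d ∈ Classes.P := by
  classical
  let G : List Bool → Bool := fun w => dec (ofTuple (decTuple w)).toILP && decide (tupleE (decTuple w) = w)
  have hcanon : CodeFP strE strE (fun w => tupleE (decTuple w)) := decTuple_codeFP.recodeOut fun _ => rfl
  have hdec : CodeFP strE bitE (fun w => dec (ofTuple (decTuple w)).toILP) :=
    (hFP.comp (toILP_codeFP.comp decTuple_codeFP)).congr fun _ => rfl
  have heq : CodeFP strE bitE (fun w => decide (tupleE (decTuple w) = w)) :=
    ((CodeFP.eq (eα := strE) Function.injective_id).comp (hcanon.pair (CodeFP.id strE))).congr fun _ => rfl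
  have hG : CodeFP strE bitE G := (hdec.and heq).congr fun _ => rfl
  obtain ⟨g, hg, hgw⟩ := hG
  have hgw' : ∀ w, g w = [G w] := fun w => hgw w
  -- `G` decides the language
  have hGiff : ∀ w, G w = true ↔ w ∈ gsaLangOfDim d := by
    intro w
    constructor
    · intro hw
      simp only [G, Bool.and_eq_true, decide_eq_true_eq] at hw
      obtain ⟨hdec, hcode⟩ := hw
      obtain ⟨hn, hfeas⟩ := hsound _ hdec
      refine ⟨ofTuple (decTuple w), ⟨?_, (feasible_toILP_iff _).1 hfeas⟩, (encode_ofTuple_decTuple w).trans hcode⟩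
      simpa using hn
    · rintro ⟨I, ⟨hI, hyes⟩, rfl⟩
      simp only [G, Bool.and_eq_true, decide_eq_true_eq, decTuple_encode, ofTuple_toTuple, ← encode_eq_tupleE,
        and_true]
      refine hcomplete _ ?_ I.isBounded_toILP ((feasible_toILP_iff I).2 hyes)
      change I.1.1 + 1 = d + 1
      rw [hI]
  refine mem_P_of_mem_FP hg _ fun w => ⟨fun hw => ?_, fun hw => ?_⟩
  · rw [hgw', (hGiff w).2 hw]
  · rw [hgw']
    cases hGw : G w
    · rfl
    · exact absurd ((hGiff w).1 hGw) hw

/-- **Lagarias's fixed-dimension theorem, reduced to Lenstra's**: if for every `n` some polynomial-time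
(on codes) Boolean function decides feasibility soundly on all instances with `n` variables and completely
on the bounded ones, then `Lagarias1985_gsaOfDim_mem_P` holds. [cite: Lagarias1985, fixed-dimension theorem] [cite: Schrijver1986, §6.3 p. 168 and Cor. 18.7a] -/
theorem Lagarias1985_gsaOfDim_mem_P_of_deciders
    (h : ∀ n : ℕ, ∃ dec : ILPInstance → Bool, CodeFP ILPInstance.encoding.encode bitE dec ∧
      (∀ P : ILPInstance, dec P = true → P.numVars = n ∧ P.Feasible) ∧
      (∀ P : ILPInstance, P.numVars = n → P.IsBounded → P.Feasible → dec P = true)) :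
    Lagarias1985_gsaOfDim_mem_P := fun d => by
  obtain ⟨dec, hFP, hsound, hcomplete⟩ := h (d + 1)
  exact gsaLangOfDim_mem_P_of_decider d dec hFP hsound hcomplete

end SimultaneousApproxInstance

end Literature.NumberTheory.DiophantineApproximation
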